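import Mathlib
import HarnessLib
import Summits.HubbardSuperconductivity.HubbardSuperconductivity.Theorems.KLProgrammeKLRegimeSplitBundleV12
import Summits.HubbardSuperconductivity.HubbardSuperconductivity.Theorems.KLProgrammeKLRegimeWickCarriersDefs
import Summits.HubbardSuperconductivity.HubbardSuperconductivity.Theorems.KLProgrammeKLRegimeSplitPairValueBridge

/-!
# Route `KLProgramme` — crux K3 `KLRegimeTwoPointLimit` (stmt-HubbardSuperconductivity-19937): the ENGINE slot, VERSION 9 — the repaired
# pair-ladder step (E2-v9) after the E2-DRIVE finding, in BOTH carrier variants (§1 PLAIN `PairLadderStepAtV9` / `EngineBoundsAtV9S`,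
# §2 WICK `PairLadderStepAtW9` / `EngineBoundsAtW9S` + the Wick twins of every value / kernel conjunct of the engine and split slots)
# (cell gate-hubbard-kl, seat p1 g8 = clause-author lineage; plan g12 WORD (R12′)/(R13) 2026-08-27T02:02:44Z / 02:05:37Z)

E2-DRIVE RECORD (finder k3c1-p1 g4, HOME/hubbard-kl-k3c1-p1/E2-DRIVE-FINDING.md, STATUS l.1599; confirmed by the clause author p1 g8 l.1607 and by
the typing authority on structure l.1608/l.1611).  INSTANCE: `Qm = 0`, `k` on the frame's Fermi curve, `k′ = −k + δ` with `δ` tangent at `−k`,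
`v|δ| ≍ Λ_{n−1}` (`|δ| = x·Λ_{n−1}/v_F`, `x ∈ [2,8]`) ⇒ all four legs below `Λ_{n+2}` (`legSliceCountT = 0`, `1 ≪ n ≪ n_β`) and the EXCHANGE transfer
`|k+k′−Qm|_𝕋 = |δ|`; the scale-`n` increment of `𝒞_n(Qm;k,k′)` then contains the CROSSED mixed-spin particle–hole bubble at that transfer — the
Kohn–Luttinger source — of size `≈ 0.2·N₀·U²`, `n`-INDEPENDENT (the two-shell ph bubble gains only for `vρ ≫ Λ_n` or `vρ ≪ Λ_n`; the package books
`klEngGeo3.phGain n ρ = 1` on `ρ ∈ [2^{−24}Λ_n, 2^{24}Λ_n]`), which the `(k,k′)`-flat ladder correction `𝒞_{n−1}·N − 𝒞_{n−1}` cannot absorb; every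
term of the (E2-v8) budget `drivePBar(n−1) + eremBar(n−1) + thermalBar n + legDressBarQ·countT` decays in `n` ⇒ the `1 ≤ n` conjunct of (E2-v8) is
FALSE as typed for `30 + 2log₂Klam ≲ n ≲ n_β − 28 − log₂Klam` (G3), i.e. deep inside `β ≤ e^{c/U²}` for every admissible `(c, U)`.  STRUCTURE
(plan g12): (E2″-v6)/(E2′-S3) budget the FULL increment with `gainBar … n (|Qm|) (|k−k′|) (|k+k′−Qm|) = (Klam U)²(ppGain + phGain + phGain)`; (E2-v8)
subtracts the pp LADDER (which removes the pp gain at `Qm` and nothing else) and forgot the two `phGain` terms.  REPAIR (R-E2a), forced and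
engine-natural: (X) add `(P.Klam·U)²·(G.phGain n |k−k′|_𝕋 + G.phGain n |k+k′−Qm|_𝕋)` to the `1 ≤ n` budget (index `n` = `gainBar`'s convention);
NO angular-mass conjunct (ANG): the finder withdrew it (STATUS 02:25:05Z) — child 1's chain of record
(`pairLadder_envelope_edge` p473596 / `betaSplitP_of_edgeClauses` p474021) takes an ENTRYWISE nonnegative extra with a per-step sup and a POINTWISE
scale sum, which (X) has (`phGain ≤ CF`, `Σ_n phGain n ρ ≤ CF` from `G.WF`), so child 1 re-closes by `betaSplitP_of_slotsV9S` (S-sized) and a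
consumer-less engine obligation is not typed (plan g12 (R7) drop rule).  Everything else of (E2-v8) — (m) `Σ|w| ≤ bhi`, (neg) `Σ(|w|−w) ≤ 2·klEdge`, `∃ N`, the Δ19 `n = 0` clause — VERBATIM.

* §1 PLAIN: `PairLadderStepAtV9`, `EngineBoundsAtV9S` (= V8S with (E2-v8) ↦ (E2-v9), conjunct ORDER KEPT: child 1's projections `.2.2.1` … survive),
  lifts `pairLadderStepAtV9_of_V8` / `engineBoundsAtV9S_of_V8S` ((E2-v8) ⇒ (E2-v9): the added budget term is `≥ 0` under `0 ≤ phGain` — every V8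
  supplier and every V8 history lifts), `pairLadderStepAtV9_iff_V8_zero`, projections;
* §2 WICK (E2-STRUCTURE option (B), HOME/p1/E2-STRUCTURE-NOTE.md §5; rides gen 5 iff plan g12's 03:35Z variant choice says so): the same texts on
  `klWickPairAmplitude` / `klWickPairArray` / `klWickQuarticValue` / `klWickAnisoLegKernel(Norm)` / `klWickIsoKernelAt` / `klWickLegKernel`
  (p484936), conjunct for conjunct — `KernelNormsW`, `PairLadderStepAtW9`, `PairValueIncrementAtW`, `QuarticValueIncrementAtW`, `QuarticValueUVAtW`,
  `EngineFirstMomentsW`, `IsoTupleL1AtW`, `EngineBoundsAtW9S`; split side `PairArrayAtW`, `EndpointNormLineIsoW`, `QuarticValueLineW`,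
  `FirstMomentsW`, `BetaSplitAtW`; (E0) `SelfEnergySymmetric`, the renormalisation and two-leg slots stay on the PLAIN self-energy; frames, `FrameOK`,
  GenericV4, budgets, weights, `∃ w N` shape UNCHANGED; identification at the assembly scale: `pairLadderStepAtW9_iff_V9_of_lt` (+ p484936's
  `_eq_of_lt` lemmas: `𝒲_n = 𝒱_n` for `nScales β < n`); Wick twins of `…SplitPairValueBridge` for child 1's value-line consumer
  (`klWickQuarticValue_pair`, `wickQuarticValue_pair_le_of_pairArrayAtW`).

Definitions with bodies only; nothing about the model is asserted.  Bundle `…SplitBundleV14` (history `histV14 := BetaSplitAtS2 ∧ RenormalisedAtF ∧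
EngineBoundsAtV9S`, or its Wick twin) is p2's, on plan g12's word.
-/

noncomputable section

namespace Summit.HubbardSuperconductivity.HubbardSuperconductivity.Theorems.KLRegimeSplit

set_option linter.dupNamespace false -- summit = problem name (single-conjunct summit), D-0017

open Real Finset Literature.MathematicalPhysics.QuantumLattice Literature.Probability.LatticeModels
open Literature.MathematicalPhysics.QuantumLattice.FermiRG
open Summit.HubbardSuperconductivity.HubbardSuperconductivity.Theorems.KLProgrammeLegKernels
open Summit.HubbardSuperconductivity.HubbardSuperconductivity.Theorems.KLRegimeWick

section Model

variable (L M : ℕ) [NeZero L] [NeZero M]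

/-! ## §1 (E2-v9), PLAIN carriers: V8 + (X) -/

/-- **(E2-v9) one pair-ladder step per scale** — (E2-v8) verbatim plus, at `1 ≤ n`, (X): the budget carries the two crossed particle–hole gains at
the true transfers, `+ (Klam U)²·(phGain n |k − k′|_𝕋 + phGain n |k + k′ − Qm|_𝕋)` (E2-DRIVE repair (R-E2a); no angular-mass conjunct — child 1's chain
absorbs the entrywise source through its pointwise scale sum `Σ_n phGain n ρ ≤ CF`, k3c1-p1 STATUS 02:25:05Z). -/
def PairLadderStepAtV9 (G : GeoConsts) (P : SplitConsts) (Q : EngConsts) (β U μ : ℝ) (K : TrigPolyC4v) (n : ℕ) : Prop :=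
  (n = 0 → ∀ Qm : TorusSite 2 L, ∀ k ∈ klBall L μ K, ∀ k' ∈ klBall L μ K,
      ‖klPairAmplitude L M β U μ K 0 Qm k k' - (U : ℂ)‖ ≤ initDevBar G U + legDressBarQ G P Q U 0 4) ∧
  (1 ≤ n → ∀ Qm : TorusSite 2 L, IsPairClassAt L Qm n →
      ∃ w : TorusSite 2 L → ℝ, (∑ p, |w p| ≤ G.bhi) ∧ (∑ p, (|w p| - w p) ≤ 2 * klEdge G n (klTorusNorm L Qm)) ∧
        ∃ N : Matrix (TorusSite 2 L) (TorusSite 2 L) ℂ,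
          (1 + Matrix.diagonal (fun p => (w p : ℂ)) * klPairArray L M β U μ K (n - 1) Qm) * N = 1 ∧
          ∀ k ∈ klBall L μ K, ∀ k' ∈ klBall L μ K,
            ‖klPairAmplitude L M β U μ K n Qm k k' - (klPairArray L M β U μ K (n - 1) Qm * N) k k'‖ ≤
              drivePBar G P U (n - 1) + eremBar G P Q U β L (n - 1) + thermalBar G P U β n +
                legDressBarQ G P Q U n (legSliceCountT L β μ K n ![k', Qm - k', Qm - k, k]) +
                (P.Klam * U) ^ 2 * (G.phGain n (klTorusNorm L (k - k')) + G.phGain n (klTorusNorm L (k + k' - Qm))))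

/-- **`EngineBoundsAtV9S`** = `EngineBoundsAtV8S` with (E2-v8) ↦ (E2-v9), conjunct order kept. -/
def EngineBoundsAtV9S (G : GeoConsts) (P : SplitConsts) (Q : EngConsts) (β U μ : ℝ) (K : TrigPolyC4v) (n : ℕ) : Prop :=
  SelfEnergySymmetric L M β U μ K n ∧ KernelNormsV4 L M P Q β U μ K n ∧
    PairLadderStepAtV9 L M G P Q β U μ K n ∧ PairValueIncrementAtV6 L M G P Q β U μ K n ∧
      QuarticValueIncrementAtS3 L M G P Q β U μ K n ∧ QuarticValueUVAtS2 L M G P Q β U μ K n ∧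
        EngineFirstMoments L M G P Q β U μ K n ∧ IsoTupleL1AtS L M G P β U μ K n

/-! ## §2 (E2-v9) and every value / kernel conjunct on the WICK carriers (option (B)) -/

/-- **(E1-W) Wick kernel norms for `p ≥ 2`** (twin of `KernelNormsV4` on `klWickAnisoLegKernelNorm`). -/
def KernelNormsW (P : SplitConsts) (Q : EngConsts) (β U μ : ℝ) (K : TrigPolyC4v) (n : ℕ) : Prop :=
  ∀ p : ℕ, 2 ≤ p →
    klWickAnisoLegKernelNorm L M β U μ K n (2 * p) ≤
      Q.CE ^ p * (epsCoupling P U n) ^ (p - 1) * (2 : ℝ) ^ ((3 * (p : ℤ) - 5) * n)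

/-- **(E2-W9) the pair-ladder step on the Wick pair amplitude** (twin of `PairLadderStepAtV9`). -/
def PairLadderStepAtW9 (G : GeoConsts) (P : SplitConsts) (Q : EngConsts) (β U μ : ℝ) (K : TrigPolyC4v) (n : ℕ) : Prop :=
  (n = 0 → ∀ Qm : TorusSite 2 L, ∀ k ∈ klBall L μ K, ∀ k' ∈ klBall L μ K,
      ‖klWickPairAmplitude L M β U μ K 0 Qm k k' - (U : ℂ)‖ ≤ initDevBar G U + legDressBarQ G P Q U 0 4) ∧
  (1 ≤ n → ∀ Qm : TorusSite 2 L, IsPairClassAt L Qm n →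
      ∃ w : TorusSite 2 L → ℝ, (∑ p, |w p| ≤ G.bhi) ∧ (∑ p, (|w p| - w p) ≤ 2 * klEdge G n (klTorusNorm L Qm)) ∧
        ∃ N : Matrix (TorusSite 2 L) (TorusSite 2 L) ℂ,
          (1 + Matrix.diagonal (fun p => (w p : ℂ)) * klWickPairArray L M β U μ K (n - 1) Qm) * N = 1 ∧
          ∀ k ∈ klBall L μ K, ∀ k' ∈ klBall L μ K,
            ‖klWickPairAmplitude L M β U μ K n Qm k k' - (klWickPairArray L M β U μ K (n - 1) Qm * N) k k'‖ ≤
              drivePBar G P U (n - 1) + eremBar G P Q U β L (n - 1) + thermalBar G P U β n +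
                legDressBarQ G P Q U n (legSliceCountT L β μ K n ![k', Qm - k', Qm - k, k]) +
                (P.Klam * U) ^ 2 * (G.phGain n (klTorusNorm L (k - k')) + G.phGain n (klTorusNorm L (k + k' - Qm))))

/-- **(E2″-W) value increments of the Wick pair amplitude** (twin of `PairValueIncrementAtV6`). -/
def PairValueIncrementAtW (G : GeoConsts) (P : SplitConsts) (Q : EngConsts) (β U μ : ℝ) (K : TrigPolyC4v) (n : ℕ) : Prop :=
  1 ≤ n → ∀ Qm : TorusSite 2 L, ∀ k ∈ klBall L μ K, ∀ k' ∈ klBall L μ K,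
    ‖klWickPairAmplitude L M β U μ K n Qm k k' - klWickPairAmplitude L M β U μ K (n - 1) Qm k k'‖ ≤
      gainBar G P U n (klTorusNorm L Qm) (klTorusNorm L (k - k')) (klTorusNorm L (k + k' - Qm)) +
        eremBar G P Q U β L (n - 1) + thermalBar G P U β n +
          legDressBarQ G P Q U n (legSliceCountT L β μ K n ![k', Qm - k', Qm - k, k])

/-- **(E2′-W) pointwise increments of the `↑↓` Wick running coupling values** (twin of `QuarticValueIncrementAtS3`). -/
def QuarticValueIncrementAtW (G : GeoConsts) (P : SplitConsts) (Q : EngConsts) (β U μ : ℝ) (K : TrigPolyC4v) (n : ℕ) : Prop :=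
  1 ≤ n → ∀ k₁ ∈ klBall L μ K, ∀ k₂ ∈ klBall L μ K, ∀ k₃ ∈ klBall L μ K,
    ‖klWickQuarticValue L M β U μ K n 0 1 k₁ k₂ k₃ - klWickQuarticValue L M β U μ K (n - 1) 0 1 k₁ k₂ k₃‖ ≤
      gainBar G P U n (klTorusNorm L (k₁ + k₃)) (klTorusNorm L (k₁ - k₂)) (klTorusNorm L (k₂ - k₃)) +
        eremBar G P Q U β L (n - 1) + thermalBar G P U β n +
          legDressBarQ G P Q U n (legSliceCountT L β μ K n ![k₁, k₂, k₃, k₁ - k₂ + k₃])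

/-- **(E2′-W uv) the scale-`0` Wick coupling values** (twin of `QuarticValueUVAtS2`). -/
def QuarticValueUVAtW (G : GeoConsts) (P : SplitConsts) (Q : EngConsts) (β U μ : ℝ) (K : TrigPolyC4v) (n : ℕ) : Prop :=
  n = 0 → ∀ k₁ ∈ klBall L μ K, ∀ k₂ ∈ klBall L μ K, ∀ k₃ ∈ klBall L μ K,
    ‖klWickQuarticValue L M β U μ K 0 0 1 k₁ k₂ k₃‖ ≤ |U| + initDevBar G U + legDressBarQ G P Q U 0 4

/-- **(E4-W) first moments of the quartic Wick kernel** (twin of `EngineFirstMoments` on `klWickAnisoLegKernel`). -/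
def EngineFirstMomentsW (G : GeoConsts) (P : SplitConsts) (Q : EngConsts) (β U μ : ℝ) (K : TrigPolyC4v) (n : ℕ) : Prop :=
  ∀ Ω : Fin 4 → SectorLeg (sectorCount n), ∀ i k : Fin 4,
    imagTimeWeight β M ^ 3 *
        ∑ x : Fin 3 → SpaceTimeIdx L M,
          spaceTimeDist L M β (Matrix.vecCons (0 : SpaceTimeIdx L M) x i) (Matrix.vecCons (0 : SpaceTimeIdx L M) x k) *
            ‖klWickAnisoLegKernel L M β U μ K n 4 Ω (Matrix.vecCons (0 : SpaceTimeIdx L M) x)‖ ≤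
      (G.cE4 + Q.cE4 * |U|) * P.Klam * |U| * (4 : ℝ) ^ n

/-- **(E5-W) Wick `↑↓` values ⇒ fixed-tuple `L¹` of the isotropic Wick kernels** (twin of `IsoTupleL1AtS`). -/
def IsoTupleL1AtW (G : GeoConsts) (P : SplitConsts) (β U μ : ℝ) (K : TrigPolyC4v) (n : ℕ) : Prop :=
  ∀ B : ℝ, 0 ≤ B →
    (∀ k₁ ∈ klBall L μ K, ∀ k₂ ∈ klBall L μ K, ∀ k₃ ∈ klBall L μ K, ‖klWickQuarticValue L M β U μ K n 0 1 k₁ k₂ k₃‖ ≤ B) →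
      ∀ m : ℕ, n ≤ m → ∀ Ω ∈ bgmSectorSet L M (klIsoFamily L M β μ K klE0 m) 4, ∀ x₁ : SpaceTimeIdx L M,
        fixedTupleL1 L M β 3 (klWickIsoKernelAt L M β U μ K n m) Ω x₁ ≤ G.CF * B + G.CF * (P.Klam * U) ^ 2

/-- **`EngineBoundsAtW9S … G P Q K n`** — the engine slot on the Wick carriers: (E0) on the PLAIN self-energy (the renormalisation conditions are
plain) ∧ (E1-W) ∧ (E2-W9) ∧ (E2″-W) ∧ (E2′-W) ∧ (E2′-W uv) ∧ (E4-W) ∧ (E5-W).  Same slot type as `Preds.engine`. -/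
def EngineBoundsAtW9S (G : GeoConsts) (P : SplitConsts) (Q : EngConsts) (β U μ : ℝ) (K : TrigPolyC4v) (n : ℕ) : Prop :=
  SelfEnergySymmetric L M β U μ K n ∧ KernelNormsW L M P Q β U μ K n ∧
    PairLadderStepAtW9 L M G P Q β U μ K n ∧ PairValueIncrementAtW L M G P Q β U μ K n ∧
      QuarticValueIncrementAtW L M G P Q β U μ K n ∧ QuarticValueUVAtW L M G P Q β U μ K n ∧
        EngineFirstMomentsW L M G P Q β U μ K n ∧ IsoTupleL1AtW L M G P β U μ K n

/-- **(B1-W) the Wick pair arrays are constant on the ball up to the `Q`-aware tolerance** (twin of `PairArrayAtV2`). -/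
def PairArrayAtW (P : SplitConsts) (Q : EngConsts) (β U μ : ℝ) (K : TrigPolyC4v) (n : ℕ) : Prop :=
  ∀ Qm : TorusSite 2 L,
    ∃ u : ℝ, 0 ≤ u ∧ u ≤ 2 * |U| ∧ ∀ k ∈ klBall L μ K, ∀ k' ∈ klBall L μ K,
      ‖klWickPairAmplitude L M β U μ K n Qm k k' - (u : ℂ)‖ ≤ (P.C_W + klLegKappa * Q.CR * P.Klam ^ 3) * U ^ 2

/-- **(B2-W iso) the isotropic endpoint norm line on the Wick quartic kernel** (twin of `EndpointNormLineIso`). -/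
def EndpointNormLineIsoW (P : SplitConsts) (β U μ : ℝ) (K : TrigPolyC4v) (n : ℕ) : Prop :=
  ∀ Ω ∈ bgmSectorSet L M (klIsoFamily L M β μ K klE0 n) 4, ∀ x₁ : SpaceTimeIdx L M,
    fixedTupleL1 L M β 3 (klWickLegKernel L M β U μ K n 4) Ω x₁ ≤ P.Klam * |U|

/-- **(B2-W value) the `↑↓` Wick value line** (twin of `QuarticValueLineS`). -/
def QuarticValueLineW (P : SplitConsts) (β U μ : ℝ) (K : TrigPolyC4v) (n : ℕ) : Prop :=
  ∀ k₁ ∈ klBall L μ K, ∀ k₂ ∈ klBall L μ K, ∀ k₃ ∈ klBall L μ K, ‖klWickQuarticValue L M β U μ K n 0 1 k₁ k₂ k₃‖ ≤ P.Klam * |U|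

/-- **(B4-W) first moments of the quartic Wick kernel** (twin of `FirstMoments`). -/
def FirstMomentsW (P : SplitConsts) (β U μ : ℝ) (K : TrigPolyC4v) (n : ℕ) : Prop :=
  ∀ Ω : Fin 4 → SectorLeg (sectorCount n), ∀ i k : Fin 4,
    imagTimeWeight β M ^ 3 *
        ∑ x : Fin 3 → SpaceTimeIdx L M,
          spaceTimeDist L M β (Matrix.vecCons (0 : SpaceTimeIdx L M) x i) (Matrix.vecCons (0 : SpaceTimeIdx L M) x k) *
            ‖klWickAnisoLegKernel L M β U μ K n 4 Ω (Matrix.vecCons (0 : SpaceTimeIdx L M) x)‖ ≤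
      P.Cd * P.Klam * |U| * (4 : ℝ) ^ n

/-- **`BetaSplitAtW … G P Q K n`** := `PairArrayAtW ∧ (EndpointNormLineIsoW ∧ QuarticValueLineW) ∧ FirstMomentsW` (twin of `BetaSplitAtS2`). -/
def BetaSplitAtW (_G : GeoConsts) (P : SplitConsts) (Q : EngConsts) (β U μ : ℝ) (K : TrigPolyC4v) (n : ℕ) : Prop :=
  PairArrayAtW L M P Q β U μ K n ∧ (EndpointNormLineIsoW L M P β U μ K n ∧ QuarticValueLineW L M P β U μ K n) ∧
    FirstMomentsW L M P β U μ K n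

end Model

/-! ## §3 Bookkeeping -/

section Model

variable {L M : ℕ} [NeZero L] [NeZero M] {G : GeoConsts} {P : SplitConsts} {Q : EngConsts} {β U μ : ℝ} {K : TrigPolyC4v} {n : ℕ}

/-- **(E2-v8) ⇒ (E2-v9)** when `0 ≤ G.phGain` (the V9 budget is LARGER: the two crossed-gain terms are added): every V8-keyed supplier
lemma lifts for free. -/
theorem pairLadderStepAtV9_of_V8 (hG : ∀ m ρ, 0 ≤ G.phGain m ρ) (h : PairLadderStepAtV8 L M G P Q β U μ K n) :
    PairLadderStepAtV9 L M G P Q β U μ K n := by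
  refine ⟨h.1, fun hn Qm hQ => ?_⟩
  obtain ⟨w, hm, hneg, N, hN, hbd⟩ := h.2 hn Qm hQ
  refine ⟨w, hm, hneg, N, hN, fun k hk k' hk' => (hbd k hk k' hk').trans ?_⟩
  have : 0 ≤ (P.Klam * U) ^ 2 * (G.phGain n (klTorusNorm L (k - k')) + G.phGain n (klTorusNorm L (k + k' - Qm))) :=
    mul_nonneg (sq_nonneg _) (add_nonneg (hG _ _) (hG _ _))
  linarith

/-- At `n = 0` the plain and the V8 clause agree. -/
theorem pairLadderStepAtV9_iff_V8_zero (G : GeoConsts) (P : SplitConsts) (Q : EngConsts) (β U μ : ℝ) (K : TrigPolyC4v) :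
    PairLadderStepAtV9 L M G P Q β U μ K 0 ↔ PairLadderStepAtV8 L M G P Q β U μ K 0 := by
  simp only [PairLadderStepAtV9, PairLadderStepAtV8, Nat.le_zero, one_ne_zero, IsEmpty.forall_iff, and_true]

/-- **`EngineBoundsAtV8S ⇒ EngineBoundsAtV9S`** (`G.WF` gives `0 ≤ phGain`): every V8-keyed supplier lifts; in particular a V8 history is a V9
history. -/
theorem engineBoundsAtV9S_of_V8S (hG : G.WF) (h : EngineBoundsAtV8S L M G P Q β U μ K n) : EngineBoundsAtV9S L M G P Q β U μ K n :=
  ⟨h.1, h.2.1, pairLadderStepAtV9_of_V8 hG.2.2.2.2.2.2.2.2.2.2.2.2.1 h.2.2.1, h.2.2.2.1, h.2.2.2.2.1, h.2.2.2.2.2.1, h.2.2.2.2.2.2.1,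
    h.2.2.2.2.2.2.2⟩

/-- Projection: (E2-v9) is the third conjunct of `EngineBoundsAtV9S` (child 1 reads `.2.2.1`). -/
theorem pairLadderStepAtV9_of_engineBoundsAtV9S (h : EngineBoundsAtV9S L M G P Q β U μ K n) :
    PairLadderStepAtV9 L M G P Q β U μ K n := h.2.2.1

/-- Projection: every conjunct of `EngineBoundsAtV9S` other than (E2) is V8S's, so the V8S-minus-(E2) data are recovered verbatim. -/
theorem engineBoundsAtV9S_rest (h : EngineBoundsAtV9S L M G P Q β U μ K n) :
    SelfEnergySymmetric L M β U μ K n ∧ KernelNormsV4 L M P Q β U μ K n ∧ PairValueIncrementAtV6 L M G P Q β U μ K n ∧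
      QuarticValueIncrementAtS3 L M G P Q β U μ K n ∧ QuarticValueUVAtS2 L M G P Q β U μ K n ∧
        EngineFirstMoments L M G P Q β U μ K n ∧ IsoTupleL1AtS L M G P β U μ K n :=
  ⟨h.1, h.2.1, h.2.2.2.1, h.2.2.2.2.1, h.2.2.2.2.2.1, h.2.2.2.2.2.2.1, h.2.2.2.2.2.2.2⟩

/-- At `n = 0` the V9 and V8 engine slots agree ((X) lives in the `1 ≤ n` conjunct). -/
theorem engineBoundsAtV9S_iff_V8S_zero (G : GeoConsts) (P : SplitConsts) (Q : EngConsts) (β U μ : ℝ) (K : TrigPolyC4v) :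
    EngineBoundsAtV9S L M G P Q β U μ K 0 ↔ EngineBoundsAtV8S L M G P Q β U μ K 0 := by
  simp only [EngineBoundsAtV9S, EngineBoundsAtV8S, pairLadderStepAtV9_iff_V8_zero]

/-- Projection (Wick): (E2-W9) is the third conjunct of `EngineBoundsAtW9S`. -/
theorem pairLadderStepAtW9_of_engineBoundsAtW9S (h : EngineBoundsAtW9S L M G P Q β U μ K n) :
    PairLadderStepAtW9 L M G P Q β U μ K n := h.2.2.1

/-- **Wick twin of `klQuarticValue_pair`** (`…SplitPairValueBridge`): at pair kinematics the Wick running coupling value IS the Wick pair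
amplitude, `klWickQuarticValue … n 0 1 k′ k (Q − k′) = klWickPairAmplitude … n Q k k′` (same label tuples on `𝒲_n`; `kernel_four_cycle`). -/
theorem klWickQuarticValue_pair (β U μ : ℝ) (K : TrigPolyC4v) (n : ℕ) (Q k k' : TorusSite 2 L) :
    klWickQuarticValue L M β U μ K n 0 1 k' k (Q - k') = klWickPairAmplitude L M β U μ K n Q k k' := by
  have hk : k' - k + (Q - k') = Q - k := by abel
  simp only [klWickQuarticValue, klWickPairAmplitude, vertexFn, hk]
  congr 1
  exact kernel_four_cycle _ _ _ _ _

/-- **Wick twin of `quarticValue_pair_le_of_pairArrayAt`**: (B1-W) supplies the Wick value line at pair kinematics,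
`|λ^W_n(k′, k, Q − k′)| ≤ 2|U| + (C_W + klLegKappa·CR·Klam³)·U²` on the ball. -/
theorem wickQuarticValue_pair_le_of_pairArrayAtW (h : PairArrayAtW L M P Q β U μ K n) (Qm : TorusSite 2 L) {k k' : TorusSite 2 L}
    (hk : k ∈ klBall L μ K) (hk' : k' ∈ klBall L μ K) :
    ‖klWickQuarticValue L M β U μ K n 0 1 k' k (Qm - k')‖ ≤ 2 * |U| + (P.C_W + klLegKappa * Q.CR * P.Klam ^ 3) * U ^ 2 := by
  obtain ⟨u, hu0, hu2, hdev⟩ := h Qm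
  rw [klWickQuarticValue_pair]
  have hd := hdev k hk k' hk'
  calc ‖klWickPairAmplitude L M β U μ K n Qm k k'‖
      = ‖(klWickPairAmplitude L M β U μ K n Qm k k' - (u : ℂ)) + (u : ℂ)‖ := by rw [sub_add_cancel]
    _ ≤ ‖klWickPairAmplitude L M β U μ K n Qm k k' - (u : ℂ)‖ + ‖(u : ℂ)‖ := norm_add_le _ _
    _ ≤ (P.C_W + klLegKappa * Q.CR * P.Klam ^ 3) * U ^ 2 + 2 * |U| := by
        rw [Complex.norm_real, Real.norm_eq_abs, abs_of_nonneg hu0]; exact add_le_add hd hu2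
    _ = 2 * |U| + (P.C_W + klLegKappa * Q.CR * P.Klam ^ 3) * U ^ 2 := by ring

/-- Beyond the thermal scale the Wick and the plain (E2-v9) clauses coincide (all carriers agree there, p484936). -/
theorem pairLadderStepAtW9_iff_V9_of_lt {β : ℝ} (hβ : 0 < β) (G : GeoConsts) (P : SplitConsts) (Q : EngConsts) (U μ : ℝ)
    (K : TrigPolyC4v) {n : ℕ} (hn : nScales β < n) (hn1 : nScales β < n - 1) :
    PairLadderStepAtW9 L M G P Q β U μ K n ↔ PairLadderStepAtV9 L M G P Q β U μ K n := by
  have h0 : n ≠ 0 := by omega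
  simp only [PairLadderStepAtW9, PairLadderStepAtV9, h0, IsEmpty.forall_iff, true_and,
    klWickPairAmplitude_eq_of_lt L M hβ U μ K hn, klWickPairArray_eq_of_lt L M hβ U μ K hn1]

end Model

end Summit.HubbardSuperconductivity.HubbardSuperconductivity.Theorems.KLRegimeSplit

end
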